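import Literature.MathematicalPhysics.QuantumFieldTheory.Balaban1983to89.Node00.Record12MeasurabilityAtRecord
import Literature.MathematicalPhysics.QuantumFieldTheory.Balaban1983to89.Node00.Record12MeasurabilityAnySelector

/-!
# NODE 00 — K0′ COMPONENTS G3, FILE 7: rows P1 `intPiece`, P2 `measω`, P3 `measChi` ALONG AN ARBITRARY HISTORY and normalisation — the history-generic
# faces a successor record (director-ym №125 «RECORD 13»: histories `gOfRecord₁₃`, normalisations `EOfRecord₁₃`) cites BY NAME (CLOSABILITY GATE row B5)

Cell `pub-ymgap`, NODE 00, prover seat `pub-ymgap-node00-def-K0c` (g3); K0′ = `stmt-QuantumFields-19902`; GATE rows P1–P3 ∕ B5 (`RECORD13-CLOSABILITY-GATE.md`).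
[III] = [Balaban1988Convergent], [IV] = [Balaban1989LargeFieldI].

WHY.  FILE 1 §5 (`Stage9Params.measChi_∕measω_∕intPiece_of_localBg`), FILE 2 (`…intPiece_of_localBg_anySel`) and FILE 3 ∕ 6 state the three rows along the Stage-10
histories `gOfRecord₁₀ θ` and normalisations `EOfRecord₁₀ θ` — the texts of `Provisos₁₀`.  The successor record `Record13` (def-T g7, №125) reads the SAME carriers
(`chiSeqOfRecord`, `ωOfRecord`, `wOfRecord₉`, `slotsOfRecord`) along OTHER histories (`gOfRecord₁₃ := genSeq (betaOfRecord₉cOn θ) ·`) and normalisations (`EOfRecord₁₃`);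
the CORES are history-generic (FILE 1 §2–§3 take any `g : ℕ → ℝ`; FILE 2 §3 `piece_slotsOfRecord_measurable_integrable` any `E`, `w`, selector, history).  This file
states the three rows ONCE for an ARBITRARY run-indexed history `g : B12.RunParams → ℕ → ℝ` and normalisation `E : B12.RunParams → ℝ`, at a Stage-9 parameter (ζ-laws
displayed) and at a Stage-12 parameter carrying K0b's residuals of record (ζ-laws discharged), so that `Provisos₁₃.intPiece ∕ .measω ∕ .measChi` — and any later
re-keying of the histories — are these theorems at `g := gOfRecord₁₃ F N θ.toStage9Params`, `E := EOfRecord₁₃ F N θ.toStage9Params`, BY NAME, modulo (H-U) alone.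

WHAT THIS FILE PROVES (theorems only).  §1 `Stage9Params.measChi_of_localBg_hist` · `…measω_of_localBg_hist` · `…intPiece_of_localBg_hist` (any selector; (H-U), (H-ζ),
`Σ|ζ| ≤ 1`, `0 ≤ ζ` displayed).  §2 `Stage12Params.measChi_∕measω_∕intPiece_of_localBg_of_residuals_hist` (K0b's residuals: only (H-U) displayed).  §3 (remark): at
`g := gOfRecord₁₀ θ`, `E := EOfRecord₁₀ θ` these ARE FILE 1 ∕ 2's rows letter for letter (the gate's dedup lint identifies them; nothing re-declared).
(H-U) `LocalBgMeasurable F N θ.ν`: located-open by design for the bare-choice `UminOfRecord`; DISCHARGED under either implementation of №125's (H-U) re-point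
(decision D1: (A) 𝔟-parametric carriers at `bgSelFamOfRecord`, (B) `UminOfRecord` v2 in place — `HOME/pub-ymgap-node00-def-K0c/UMIN-V2-PATCHSET.md`).

HONEST FRAMING — what this is NOT.  One-line instantiations of FILE 1 ∕ 2's cores; (H-U) and the ζ-laws are DISPLAYED hypotheses; nothing of Bałaban's is asserted;
no field of any `Provisos` record is inhabited absolutely at `N ≥ 2`; K0′ is NOT discharged; counts unmoved (typed 28∕28 · discharged 5∕28).  One finite four-torus
programme at fixed `ε = L^{−K}` — NOT the continuum limit, NOT infinite volume, NOT OS, NOT a mass gap, NOT the Clay problem.  No `sorry` ∕ `axiom` ∕ `def` ∕ `instance` ∕ `notation`.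
-/

noncomputable section

open MeasureTheory

namespace Literature.MathematicalPhysics.QuantumFieldTheory.Balaban1983to89.Node00

open T4Continuum B14.Eq218Concrete T4AveragingDisintegration T4FiniteEpsInhabited B14.Sect3Decomp

variable (F : T4Family) (N : ℕ) [NeZero N]

/-! ## §1. The three rows at a Stage-9 parameter along an ARBITRARY history `g` and normalisation `E` (any selector) -/

section Stage9Hist

variable {F N}

/-- **ROW P3 ALONG ANY HISTORY**: under (H-U), for every run-indexed history `g`, run `p`, step `k < K` and new sequence `s′`, the front factor `χ_{k+1}(s′)` along `g p`
is measurable — FILE 1's core `measurable_chiSeqOfRecord_of_localBg` (the shape of `Provisos₁₀.measChi` ∕ `Provisos₁₃.measChi` with the history a parameter).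
[cite: Balaban1988Convergent, (2.17)–(2.18) p.257, (3.2) p.265 (bookkeeping)] -/
theorem Stage9Params.measChi_of_localBg_hist (θ : Stage9Params F N) (hU : LocalBgMeasurable F N θ.ν) (g : B12.RunParams → ℕ → ℝ) :
    ∀ (p : B12.RunParams) (k : ℕ), k < p.K → ∀ s' : SeqOfRecord F θ.ν θ.τ9.M (g p) p.K (k + 1),
      Measurable (chiSeqOfRecord F N θ.ν θ.τ9.M (g p) p.K (k + 1) s') :=
  fun p k _ s' => measurable_chiSeqOfRecord_of_localBg hU θ.τ9.M _ p.K (k + 1) s'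

/-- **ROW P2 ALONG ANY HISTORY**: under (H-U) ∧ (H-ζ), the label weights `ω = a·b·ζ` of record at `θ.A₁`, `θ.ζ` along `g p` are jointly measurable in `(V′, U)` —
FILE 1's core `measurable_ωOfRecord_of_localBg`. [cite: Balaban1988Convergent, (3.2)–(3.5) p.265, (3.16) p.268, (3.24)–(3.25) p.270 (bookkeeping)] -/
theorem Stage9Params.measω_of_localBg_hist (θ : Stage9Params F N) (hU : LocalBgMeasurable F N θ.ν) (hζ : ZetaMeasurable F N θ.ζ)
    (g : B12.RunParams → ℕ → ℝ) :
    ∀ (p : B12.RunParams) (k : ℕ), k < p.K → ∀ (s : SeqOfRecord F θ.ν θ.τ9.M (g p) p.K k) (t : LbOfRecord F θ.ν p (g p) k),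
      Measurable (fun z : GaugeField (F.P p.K) (k + 1) (SU N) × GaugeField (F.P p.K) k (SU N) =>
        ωOfRecord F N θ.ν θ.τ9.M p (g p) k θ.A₁ θ.ζ s t z.2 z.1) :=
  fun p k _ s t => measurable_ωOfRecord_of_localBg hU θ.τ9.M p _ k θ.A₁ hζ s t

/-- **ROW P1 ALONG ANY HISTORY AND NORMALISATION, ANY SELECTOR**: under (H-U) ∧ (H-ζ) ∧ `Σ|ζ| ≤ 1` ∧ `0 ≤ ζ`, the level-`k` pieces `χ_k(s)·slot_k(s)` of the represented
tower of record along `g p` with normalisations `E` and the step weights of record `wOfRecord₉ θ` are integrable, `k < K` — FILE 2's core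
`piece_slotsOfRecord_measurable_integrable` (the shape of `Provisos₁₀.intPiece` ∕ `Provisos₁₃.intPiece` with history and normalisation as parameters; NO bound on the
marginal density of the averaging transport). [cite: Balaban1988Convergent, (2.18) p.257, (3.24)–(3.25) p.270; Balaban1989LargeFieldI, (0.3)–(0.4) p.176 (bookkeeping)] -/
theorem Stage9Params.intPiece_of_localBg_hist (θ : Stage9Params F N) (hU : LocalBgMeasurable F N θ.ν) (hζ : ZetaMeasurable F N θ.ζ)
    (hζa : IsZetaAbsLeOne F N θ.ν θ.τ9.M θ.ζ) (hζ0 : ∀ p g k s Pl Ql RS U V', 0 ≤ θ.ζ p g k s Pl Ql RS U V')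
    (E : B12.RunParams → ℝ) (g : B12.RunParams → ℕ → ℝ) :
    ∀ (p : B12.RunParams) (k : ℕ), k < p.K → ∀ s : SeqOfRecord F θ.ν θ.τ9.M (g p) p.K k,
      Integrable (fun U => chiSeqOfRecord F N θ.ν θ.τ9.M (g p) p.K k s U *
        slotsOfRecord F N θ.ν θ.τ9 E (wOfRecord₉ F N θ) θ.ppSel p (g p) k s U) (fieldMeasure (F.P p.K) k (SU N)) :=
  fun p k hk s => (piece_slotsOfRecord_measurable_integrable F N θ.ν θ.τ9 E θ.ppSel
    (fun j _ s' => measurable_wOfRecord_of_localBg hU θ.τ9.M θ.A₁ hζ p _ j s')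
    (fun j _ s' U V' => abs_wOfRecord_le_one F N θ.ν θ.τ9.M θ.A₁ hζa p _ j s' U V')
    (fun p' g' j s' U V' => wOfRecord_nonneg F N θ.ν θ.τ9.M p' g' j θ.A₁ hζ0 s' U V')
    (fun j _ s' => measurable_chiSeqOfRecord_of_localBg hU θ.τ9.M _ p.K j s') k hk.le).2 s

/-- The slots along any history are MEASURABLE (same core, first component), every level `k ≤ K`. [cite: Balaban1988Convergent, (2.18) p.257 (bookkeeping)] -/
theorem Stage9Params.measurable_slotsOfRecord_of_localBg_hist (θ : Stage9Params F N) (hU : LocalBgMeasurable F N θ.ν) (hζ : ZetaMeasurable F N θ.ζ)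
    (hζa : IsZetaAbsLeOne F N θ.ν θ.τ9.M θ.ζ) (hζ0 : ∀ p g k s Pl Ql RS U V', 0 ≤ θ.ζ p g k s Pl Ql RS U V')
    (E : B12.RunParams → ℝ) (g : B12.RunParams → ℕ → ℝ) :
    ∀ (p : B12.RunParams) (k : ℕ), k ≤ p.K → ∀ s : SeqOfRecord F θ.ν θ.τ9.M (g p) p.K k,
      Measurable (slotsOfRecord F N θ.ν θ.τ9 E (wOfRecord₉ F N θ) θ.ppSel p (g p) k s) :=
  fun p k hk s => (piece_slotsOfRecord_measurable_integrable F N θ.ν θ.τ9 E θ.ppSel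
    (fun j _ s' => measurable_wOfRecord_of_localBg hU θ.τ9.M θ.A₁ hζ p _ j s')
    (fun j _ s' U V' => abs_wOfRecord_le_one F N θ.ν θ.τ9.M θ.A₁ hζa p _ j s' U V')
    (fun p' g' j s' U V' => wOfRecord_nonneg F N θ.ν θ.τ9.M p' g' j θ.A₁ hζ0 s' U V')
    (fun j _ s' => measurable_chiSeqOfRecord_of_localBg hU θ.τ9.M _ p.K j s') k hk).1 s

end Stage9Hist

/-! ## §2. The three rows at a Stage-12 parameter carrying K0b's residuals of record, along an arbitrary history: only (H-U) displayed -/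

section Stage12Hist

variable {F N}

/-- **ROW P3 ALONG ANY HISTORY, residuals of record** (the row reads neither the residuals nor the selector). [cite: Balaban1988Convergent, (2.17)–(2.18) p.257, (3.2) p.265 (bookkeeping)] -/
theorem Stage12Params.measChi_of_localBg_of_residuals_hist (θ : Stage12Params F N) (hU : LocalBgMeasurable F N θ.ν)
    (g : B12.RunParams → ℕ → ℝ) :
    ∀ (p : B12.RunParams) (k : ℕ), k < p.K → ∀ s' : SeqOfRecord F θ.ν θ.τ9.M (g p) p.K (k + 1),
      Measurable (chiSeqOfRecord F N θ.ν θ.τ9.M (g p) p.K (k + 1) s') :=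
  θ.toStage9Params.measChi_of_localBg_hist hU g

/-- **ROW P2 ALONG ANY HISTORY, residuals of record**: (H-ζ) is FILE 3's `zetaMeasurable_zeta316OfRecord_of_localBg` through `HasResidualsOfRecord.zeta_eq`.
[cite: Balaban1988Convergent, (3.2)–(3.5) p.265, (3.16) p.268, (3.24)–(3.25) p.270 (bookkeeping)] -/
theorem Stage12Params.measω_of_localBg_of_residuals_hist (θ : Stage12Params F N) (hU : LocalBgMeasurable F N θ.ν) (hres : θ.HasResidualsOfRecord F N)
    (g : B12.RunParams → ℕ → ℝ) :
    ∀ (p : B12.RunParams) (k : ℕ), k < p.K → ∀ (s : SeqOfRecord F θ.ν θ.τ9.M (g p) p.K k) (t : LbOfRecord F θ.ν p (g p) k),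
      Measurable (fun z : GaugeField (F.P p.K) (k + 1) (SU N) × GaugeField (F.P p.K) k (SU N) =>
        ωOfRecord F N θ.ν θ.τ9.M p (g p) k θ.A₁ θ.ζ s t z.2 z.1) :=
  θ.toStage9Params.measω_of_localBg_hist hU (by rw [hres.zeta_eq]; exact zetaMeasurable_zeta316OfRecord_of_localBg hU θ.τ9.M θ.A₁) g

/-- **ROW P1 ALONG ANY HISTORY AND NORMALISATION, ANY SELECTOR, residuals of record**: (H-ζ), `Σ|ζ| ≤ 1`, `0 ≤ ζ` are K0b's laws of `zeta316OfRecord`.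
[cite: Balaban1988Convergent, (2.18) p.257, (3.16) p.268, (3.24)–(3.25) p.270; Balaban1989LargeFieldI, (0.3)–(0.4) p.176 (bookkeeping)] -/
theorem Stage12Params.intPiece_of_localBg_of_residuals_hist (θ : Stage12Params F N) (hU : LocalBgMeasurable F N θ.ν)
    (hres : θ.HasResidualsOfRecord F N) (E : B12.RunParams → ℝ) (g : B12.RunParams → ℕ → ℝ) :
    ∀ (p : B12.RunParams) (k : ℕ), k < p.K → ∀ s : SeqOfRecord F θ.ν θ.τ9.M (g p) p.K k,
      Integrable (fun U => chiSeqOfRecord F N θ.ν θ.τ9.M (g p) p.K k s U *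
        slotsOfRecord F N θ.ν θ.τ9 E (wOfRecord₉ F N θ.toStage9Params) θ.ppSel p (g p) k s U) (fieldMeasure (F.P p.K) k (SU N)) :=
  θ.toStage9Params.intPiece_of_localBg_hist hU (by rw [hres.zeta_eq]; exact zetaMeasurable_zeta316OfRecord_of_localBg hU θ.τ9.M θ.A₁) hres.zetaAbs
    (by rw [hres.zeta_eq]; exact fun p g k s Pl Ql RS U V' => zeta316OfRecord_nonneg θ.A₁ p g k s Pl Ql RS U V') E g

/-- The slots along any history at a Stage-12 parameter with the residuals of record are measurable, `k ≤ K`. [cite: Balaban1988Convergent, (2.18) p.257 (bookkeeping)] -/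
theorem Stage12Params.measurable_slotsOfRecord_of_localBg_of_residuals_hist (θ : Stage12Params F N) (hU : LocalBgMeasurable F N θ.ν)
    (hres : θ.HasResidualsOfRecord F N) (E : B12.RunParams → ℝ) (g : B12.RunParams → ℕ → ℝ) :
    ∀ (p : B12.RunParams) (k : ℕ), k ≤ p.K → ∀ s : SeqOfRecord F θ.ν θ.τ9.M (g p) p.K k,
      Measurable (slotsOfRecord F N θ.ν θ.τ9 E (wOfRecord₉ F N θ.toStage9Params) θ.ppSel p (g p) k s) :=
  θ.toStage9Params.measurable_slotsOfRecord_of_localBg_hist hU (by rw [hres.zeta_eq]; exact zetaMeasurable_zeta316OfRecord_of_localBg hU θ.τ9.M θ.A₁)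
    hres.zetaAbs (by rw [hres.zeta_eq]; exact fun p g k s Pl Ql RS U V' => zeta316OfRecord_nonneg θ.A₁ p g k s Pl Ql RS U V') E g

end Stage12Hist

/-! ## §3. Consistency (remark, no declaration): at `g := gOfRecord₁₀ F N θ`, `E := EOfRecord₁₀ F N θ` the §1 rows ARE, letter for letter, FILE 1's
`Stage9Params.measChi_of_localBg` ∕ `…measω_of_localBg` and FILE 2's `Stage9Params.intPiece_of_localBg_anySel` (the gate's `dedup.landed` lint identifies them), so no
specialisation is declared here. -/


end Literature.MathematicalPhysics.QuantumFieldTheory.Balaban1983to89.Node00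

end
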